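import Mathlib.Topology.ContinuousMap.Weierstrass
import Mathlib.Analysis.SpecialFunctions.Trigonometric.Inverse
import Mathlib.Analysis.Distribution.AEEqOfIntegralContDiff
import Mathlib.MeasureTheory.Function.LocallyIntegrable
import HarnessLib

/-!
# Odd trigonometric moments determine an integrable function on `(0, π/2)`

Topic `Literature/Analysis/FluidPDE`. Proof file (everything proved, no definitions, no named
facts) on the proof path of the named fact
`Literature.Analysis.FluidPDE.Elgindi.ElgindiGhoulMasmoudi2021_stabilityCore`
(`ElgindiStabilityDecomposition.lean`): the completeness step of the uniqueness argument for
finite-energy very weak solutions of Elgindi's polar elliptic problem (T. M. Elgindi,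
Ann. of Math. 194 (2021) = arXiv:1904.04795, §7.1 Proposition 7.1, "the unique `L²` solution").

`ae_eq_zero_of_forall_oddMoment_eq_zero`: if `g ∈ L¹((0,π/2))` and
`∫₀^{π/2} g(θ) cos θ sin^{2k+1}θ dθ = 0` for every `k`, then `g = 0` a.e. Proof: by linearity the
moments against `cos θ sin θ·r(sin²θ)` vanish for every polynomial `r`, hence (with
`cos 2θ = 1 − 2sin²θ`) against `sin 2θ·q(cos 2θ)` for every polynomial `q`; polynomials in
`cos 2θ` are uniformly dense in the continuous functions of `θ ∈ [0, π/2]` (Weierstrass on `[−1,1]`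
pulled back by the homeomorphism `θ ↦ cos 2θ`), so `∫ g sin 2θ·φ = 0` for every test function `φ`,
and the fundamental lemma of the calculus of variations gives `g sin 2θ = 0` a.e.
-/

noncomputable section

open MeasureTheory Set Real Filter Function Polynomial
open _root_.Topology
open scoped ContDiff

namespace Literature.Analysis.FluidPDE

namespace Elgindi

/-! ### Integrability of bounded continuous multiples -/

/-- A function continuous on `[0, π/2]` times an `L¹((0,π/2))` function is integrable on `(0,π/2)`. [folklore] -/
theorem integrableOn_continuous_mul {g : ℝ → ℝ} (hg : IntegrableOn g (Ioo 0 (π / 2))) {F : ℝ → ℝ}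
    (hF : ContinuousOn F (Icc 0 (π / 2))) : IntegrableOn (fun θ => g θ * F θ) (Ioo 0 (π / 2)) := by
  have := hg.mul_continuousOn_of_subset hF measurableSet_Ioo isCompact_Icc Ioo_subset_Icc_self
  exact this

/-! ### From monomial moments to polynomial moments -/

section moments

variable {g : ℝ → ℝ} (hg : IntegrableOn g (Ioo 0 (π / 2)))
  (hm : ∀ k : ℕ, ∫ θ in Ioo 0 (π / 2), g θ * (Real.cos θ * Real.sin θ ^ (2 * k + 1)) = 0)
include hg hm

/-- Moments against `cos θ sin θ·r(sin²θ)` vanish for every polynomial `r`. [folklore] -/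
theorem integral_mul_cos_sin_poly_sin_sq (r : ℝ[X]) :
    ∫ θ in Ioo 0 (π / 2), g θ * (Real.cos θ * Real.sin θ * r.eval (Real.sin θ ^ 2)) = 0 := by
  induction r using Polynomial.induction_on' with
  | add p q hp hq =>
    have ip : IntegrableOn (fun θ => g θ * (Real.cos θ * Real.sin θ * p.eval (Real.sin θ ^ 2))) (Ioo 0 (π / 2)) :=
      integrableOn_continuous_mul hg (by fun_prop)
    have iq : IntegrableOn (fun θ => g θ * (Real.cos θ * Real.sin θ * q.eval (Real.sin θ ^ 2))) (Ioo 0 (π / 2)) :=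
      integrableOn_continuous_mul hg (by fun_prop)
    have e : (fun θ => g θ * (Real.cos θ * Real.sin θ * (p + q).eval (Real.sin θ ^ 2))) =
        fun θ => g θ * (Real.cos θ * Real.sin θ * p.eval (Real.sin θ ^ 2)) + g θ * (Real.cos θ * Real.sin θ * q.eval (Real.sin θ ^ 2)) := by
      funext θ; rw [eval_add]; ring
    rw [e, integral_add ip iq, hp, hq, add_zero]
  | monomial k c =>
    have e : (fun θ => g θ * (Real.cos θ * Real.sin θ * (monomial k c).eval (Real.sin θ ^ 2))) =
        fun θ => c * (g θ * (Real.cos θ * Real.sin θ ^ (2 * k + 1))) := by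
      funext θ
      rw [eval_monomial, ← pow_mul, pow_succ, pow_mul]
      ring
    rw [e, MeasureTheory.integral_const_mul, hm k, mul_zero]

/-- Moments against `cos θ sin θ·q(cos 2θ)` vanish for every polynomial `q`. [folklore] -/
theorem integral_mul_cos_sin_poly_cos_two (q : ℝ[X]) :
    ∫ θ in Ioo 0 (π / 2), g θ * (Real.cos θ * Real.sin θ * q.eval (Real.cos (2 * θ))) = 0 := by
  have h := integral_mul_cos_sin_poly_sin_sq hg hm (q.comp (C 1 - C 2 * X))
  have e : ∀ θ, (q.comp (C 1 - C 2 * X)).eval (Real.sin θ ^ 2) = q.eval (Real.cos (2 * θ)) := fun θ => by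
    rw [eval_comp]
    congr 1
    simp only [eval_sub, eval_C, eval_mul, eval_X]
    rw [Real.cos_two_mul, Real.cos_sq']; ring
  simp only [e] at h
  exact h

/-! ### Density and the conclusion -/

/-- **Odd trigonometric moments determine `g`**: if `g ∈ L¹((0,π/2))` and
`∫ g cos θ sin^{2k+1}θ = 0` for every `k`, then `g = 0` a.e. on `(0,π/2)`. [folklore] -/
theorem ae_eq_zero_of_forall_oddMoment_eq_zero : g =ᵐ[volume.restrict (Ioo 0 (π / 2))] 0 := by
  -- Step 1: `∫ (g sin 2θ)·φ = 0` for every test function `φ` of `(0, π/2)`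
  set G : ℝ → ℝ := fun θ => g θ * Real.sin (2 * θ) with hG
  have hGi : IntegrableOn G (Ioo 0 (π / 2)) := integrableOn_continuous_mul hg (by fun_prop)
  have hpair : ∀ φ : ℝ → ℝ, ContDiff ℝ ∞ φ → HasCompactSupport φ → tsupport φ ⊆ Ioo 0 (π / 2) →
      ∫ θ, φ θ • G θ ∂(volume.restrict (Ioo 0 (π / 2))) = 0 := by
    intro φ hφ hφs hφS
    have cφ : Continuous φ := hφ.continuous
    -- `|∫ φ G| ≤ 2ε ∫|g|` for every `ε > 0`
    have hI : Integrable g (volume.restrict (Ioo 0 (π / 2))) := hg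
    set M : ℝ := ∫ θ in Ioo 0 (π / 2), |g θ| with hM
    have hM0 : 0 ≤ M := integral_nonneg fun θ => abs_nonneg _
    have key : ∀ ε : ℝ, 0 < ε → |∫ θ in Ioo 0 (π / 2), φ θ * G θ| ≤ 2 * ε * M := by
      intro ε hε
      -- Weierstrass on `[-1, 1]` for `h(x) = φ(arccos(x)/2)`
      set h : ℝ → ℝ := fun x => φ (Real.arccos x / 2) with hh
      have hc : ContinuousOn h (Icc (-1) 1) := (cφ.comp (Real.continuous_arccos.div_const 2)).continuousOn
      obtain ⟨q, hq⟩ := exists_polynomial_near_of_continuousOn (-1) 1 h hc ε hε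
      -- on `(0, π/2)`: `h(cos 2θ) = φ θ`
      have hsub : ∀ θ ∈ Ioo 0 (π / 2), |q.eval (Real.cos (2 * θ)) - φ θ| < ε := by
        intro θ hθ
        have h1 : Real.cos (2 * θ) ∈ Icc (-1:ℝ) 1 := ⟨Real.neg_one_le_cos _, Real.cos_le_one _⟩
        have h2 := hq _ h1
        have e : h (Real.cos (2 * θ)) = φ θ := by
          simp only [hh]
          rw [Real.arccos_cos (by linarith [hθ.1]) (by linarith [hθ.2])]
          congr 1; ring
        rwa [e] at h2
      -- split the integral
      have iφG : Integrable (fun θ => φ θ * G θ) (volume.restrict (Ioo 0 (π / 2))) := by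
        have : IntegrableOn (fun θ => G θ * φ θ) (Ioo 0 (π / 2)) := integrableOn_continuous_mul hGi cφ.continuousOn
        exact this.congr (ae_of_all _ fun θ => by ring)
      have iqG : Integrable (fun θ => q.eval (Real.cos (2 * θ)) * G θ) (volume.restrict (Ioo 0 (π / 2))) := by
        have : IntegrableOn (fun θ => G θ * q.eval (Real.cos (2 * θ))) (Ioo 0 (π / 2)) := integrableOn_continuous_mul hGi (by fun_prop)
        exact this.congr (ae_of_all _ fun θ => by ring)
      have hq0 : ∫ θ in Ioo 0 (π / 2), q.eval (Real.cos (2 * θ)) * G θ = 0 := by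
        have h0 := integral_mul_cos_sin_poly_cos_two hg hm q
        have e : (fun θ => q.eval (Real.cos (2 * θ)) * G θ) = fun θ => 2 * (g θ * (Real.cos θ * Real.sin θ * q.eval (Real.cos (2 * θ)))) := by
          funext θ; simp only [hG]; rw [Real.sin_two_mul]; ring
        rw [e, MeasureTheory.integral_const_mul, h0, mul_zero]
      have esplit : ∫ θ in Ioo 0 (π / 2), φ θ * G θ = ∫ θ in Ioo 0 (π / 2), (φ θ - q.eval (Real.cos (2 * θ))) * G θ := by
        have : (fun θ => (φ θ - q.eval (Real.cos (2 * θ))) * G θ) = fun θ => φ θ * G θ - q.eval (Real.cos (2 * θ)) * G θ := by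
          funext θ; ring
        rw [this, integral_sub iφG iqG, hq0, sub_zero]
      rw [esplit]
      calc |∫ θ in Ioo 0 (π / 2), (φ θ - q.eval (Real.cos (2 * θ))) * G θ|
          ≤ ∫ θ in Ioo 0 (π / 2), |(φ θ - q.eval (Real.cos (2 * θ))) * G θ| := abs_integral_le_integral_abs
        _ ≤ ∫ θ in Ioo 0 (π / 2), 2 * ε * |g θ| := by
            have isub : Integrable (fun θ => (φ θ - q.eval (Real.cos (2 * θ))) * G θ) (volume.restrict (Ioo 0 (π / 2))) :=
              (iφG.sub iqG).congr (ae_of_all _ fun θ => by simp only [Pi.sub_apply]; ring)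
            refine setIntegral_mono_on isub.abs ((hI.abs).const_mul _) measurableSet_Ioo fun θ hθ => ?_
            rw [abs_mul]
            have h1 : |φ θ - q.eval (Real.cos (2 * θ))| ≤ ε := by
              rw [abs_sub_comm]; exact (hsub θ hθ).le
            have h2 : |G θ| ≤ 2 * |g θ| := by
              simp only [hG, abs_mul]
              have := Real.abs_sin_le_one (2 * θ)
              nlinarith [abs_nonneg (g θ)]
            calc |φ θ - q.eval (Real.cos (2 * θ))| * |G θ| ≤ ε * (2 * |g θ|) := mul_le_mul h1 h2 (abs_nonneg _) hε.le
              _ = 2 * ε * |g θ| := by ring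
        _ = 2 * ε * M := by rw [MeasureTheory.integral_const_mul]
    -- hence the pairing vanishes
    have h0 : ∫ θ in Ioo 0 (π / 2), φ θ * G θ = 0 := by
      by_contra hne
      have hpos : 0 < |∫ θ in Ioo 0 (π / 2), φ θ * G θ| := abs_pos.2 hne
      by_cases hMz : M = 0
      · have := key 1 one_pos; rw [hMz, mul_zero] at this; linarith
      · have hMpos : 0 < M := lt_of_le_of_ne hM0 (Ne.symm hMz)
        have := key (|∫ θ in Ioo 0 (π / 2), φ θ * G θ| / (4 * M)) (by positivity)
        have e : 2 * (|∫ θ in Ioo 0 (π / 2), φ θ * G θ| / (4 * M)) * M = |∫ θ in Ioo 0 (π / 2), φ θ * G θ| / 2 := by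
          field_simp; ring
        rw [e] at this; linarith
    simpa [smul_eq_mul] using h0
  -- Step 2: fundamental lemma of the calculus of variations on `(0, π/2)` (measure `vol|_{(0,π/2)}`)
  have hGloc : LocallyIntegrableOn G (Ioo 0 (π / 2)) (volume.restrict (Ioo 0 (π / 2))) := by
    have : IntegrableOn G (Ioo 0 (π / 2)) (volume.restrict (Ioo 0 (π / 2))) := hGi.mono_measure Measure.restrict_le_self
    exact this.locallyIntegrableOn
  have hae := isOpen_Ioo.ae_eq_zero_of_integral_contDiff_smul_eq_zero hGloc hpair
  -- Step 3: divide by `sin 2θ > 0`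
  rw [Filter.EventuallyEq]
  have hmem : ∀ᵐ θ ∂(volume.restrict (Ioo 0 (π / 2))), θ ∈ Ioo (0:ℝ) (π / 2) := ae_restrict_mem measurableSet_Ioo
  filter_upwards [hae, hmem] with θ hθ hθm
  have hs : Real.sin (2 * θ) ≠ 0 := (Real.sin_pos_of_pos_of_lt_pi (by linarith [hθm.1]) (by linarith [hθm.2])).ne'
  have := hθ hθm
  simp only [hG, mul_eq_zero] at this
  rcases this with h | h
  · exact h
  · exact absurd h hs

end moments

end Elgindi

end Literature.Analysis.FluidPDE
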